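import Summits.AtomisticToContinuum.Crystallization.Theorems.ChartedZeroExcessLayeredLatticeLiouvilleZBA

/-!
# Part ZB «VariantLabel» (lens-2 g76) — part 2 of 2 (sequel of `…ChartedZeroExcessLayeredLatticeLiouvilleZBA`)

Split for the 400-line cap by the landing lane (hand-2 g36); the module docstring of part 1 (`…ChartedZeroExcessLayeredLatticeLiouvilleZBA`) describes the whole node.  Same namespace; all FQNs unchanged.
0 sorry; standard axioms.
-/

noncomputable section
open scoped BigOperators Classical InnerProductSpace RealInnerProductSpace
open MeasureTheory Set Metric Filter Topology
open Summit.AtomisticToContinuum.Crystallization.Theorems.ChartedPlanarOrderRigidityDoor (E3 IsClean)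
open Summit.AtomisticToContinuum.Crystallization.Theorems.ChartedPlanarOrderDensityDichotomy (μS IsSep)
open Summit.AtomisticToContinuum.Crystallization.Theorems.ChartedPlanarOrderCleanScaleP (IsCleanP IsDoorSetP isCleanP_one_iff isCleanP_mono)
open Summit.AtomisticToContinuum.Crystallization.Theorems.ChartedPlanarOrderMesoCut (LayeredHom EnvClose)
open Summit.AtomisticToContinuum.Crystallization.Theorems.ChartedPlanarOrderDoorLayeredOsc (IsTwoShellAffineGood)
open Literature.MathematicalPhysics.StatisticalMechanics (lennardJones)

namespace Summit.AtomisticToContinuum.Crystallization.Theorems.ChartedZeroExcessLayeredLatticeLiouville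


/-! ### ZB-2  The pieces (SV) / (AR) / (LN) / (CV) (typed; binders of (QE) verbatim; every constant symbolic) -/

section Pieces

/-- ★★★ **(SV) «SingleVariantP ϑc ϑp r q rsh rm σ ϑr Rs ε rI ℓ τ aHi Λ θ s» — THE LOOSE BALL IS SINGLE-VARIANT** (the shared hidden ORDER lemma of
75E, row 1344).  Under the binders of (QE) verbatim and for every cool shadow crystal `C = placedCrystal L′ w′ U t` of the shell (74D's (SC) output, as a
HYPOTHESIS): a variant label `IsVariantLabel ϑp τ ε r rm ℓ S K C lab` EXISTS — one map of the atoms near `K` into `C`, coherent on every `ϑp`-tame star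
(slops `ϑp + τ` / `2ϑp + τ`), extending REG-out on the cool zone.  MECHANISM: continuation of star models inward from the registered collar — LAYERWISE
(each close-packed layer of `C` crosses the collar in an annulus surrounding its disc inside the ball; within a layer the triangular lattice continues
without letter ambiguity, and the layer's letter is the collar's), glued by the rigidity of `13`-atom close-packed clusters at `sup`-slop `2ϑp = 1/5`
against the gap `1/√3` between distinct Barlow environments; `τ ≥ 2ϑr` absorbs the `H`-vs-`C` mismatch of (SC)'s shadow clause (iii).  INCOMPARABLE
with (CM)/(EN) formally (no localisation, no data; conversely (CM)'s slop `2d` is not `ϑp + τ`); WEAKER IN KIND — order only.  UNDECIDED→TRUE-leaning ·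
ATTACKABLE-M · INSTRUMENTABLE «Variant-T» (census cores: fit labels by continuation from the registrable shell; PASS iff max centre-pair defect
`≤ ϑp + τ` and max star-pair defect `≤ 2ϑp + τ` at `(ϑp, τ) = (1/10, 1/3000)`, collar residual `≤ ε`).
Why it might fail: a lamella of different stacking CONFINED to the loose ball (stacking-fault disc / twin lamella) admits no coherent label into `C`;
it is excluded only because its bounding Shockley partial (`|b| = 1/√3 ≈ 0.58` in nearest-neighbour units; graded over `w` rows it still forces, at some
atom, a two-shell environment misfit `≥ 0.16 > 1/16` = the cleanliness tolerance of `IsDoorSetP`, and a straddling-star misfit `> ϑp` for registry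
shifts in `(0.2, 0.38)`) must lie inside the ball where every atom is clean and every star `ϑp`-tame — a topological/order argument (no partials ⇒ every
close-packed layer through the ball is a full plane reaching the registered collar annulus, registry constant along it) to be made uniform in the
stacking word of `C`.
Sources: part UC (`IsTameStar`), parts YZ/YZA ((SC), `placedCrystal`, `EnvClose` shadow), part ZA ((EN) (a)); Hirth–Lothe ch. 10–11; Conway–Sloane
SPLAG ch. 7; CRITIC-LEDGER row 1344. [this file, g76] -/
def SingleVariantP (ϑc ϑp r q rsh rm σ ϑr Rs ε rI ℓ τ aHi Λ θ s : ℝ) : Prop :=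
  ∀ δ : ℝ, 0 < δ → ∀ a : ℝ, 0 < a →
    ∀ S : Set E3, IsDoorSetP aHi δ S → (∀ z : E3, Summable fun y : S => lennardJones (dist z (y : E3))) →
      (∀ p ∈ S, IsTwoShellAffineGood θ S p) →
        ∀ (L : E3 ≃L[ℝ] E3) (w : ℤ → E3), IsEquilChart a s Λ L w →
          ∀ (x₀ : E3) (K : Set E3), K ⊆ S → (∀ k ∈ K, dist k x₀ ≤ q) →
            IsTameOn ϑp S (LayeredHom (L : E3 →L[ℝ] E3) w) (coreOf S K rm) →
              IsTameOn ϑc S (LayeredHom (L : E3 →L[ℝ] E3) w) (moatIn S K r (r + rsh)) →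
                ∀ (L' : E3 →L[ℝ] E3) (w' : ℤ → E3) (U : E3 ≃ₗᵢ[ℝ] E3) (t : E3),
                  IsCoolShadowCrystal σ ϑr Rs ε r rI ℓ S K (LayeredHom (L : E3 →L[ℝ] E3) w) L' w' U t →
                    ∃ lab : E3 → E3, IsVariantLabel ϑp τ ε r rm ℓ S K (placedCrystal L' w' U t) lab

/-- (SV) is WEAKER for a larger mismatch slop. [this file, g76] -/
theorem SingleVariantP.of_le {ϑc ϑp r q rsh rm σ ϑr Rs ε rI ℓ τ τ' aHi Λ θ s : ℝ} (hτ : τ ≤ τ')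
    (h : SingleVariantP ϑc ϑp r q rsh rm σ ϑr Rs ε rI ℓ τ aHi Λ θ s) : SingleVariantP ϑc ϑp r q rsh rm σ ϑr Rs ε rI ℓ τ' aHi Λ θ s :=
  fun δ hδ a ha S hS hsum hgood L w hLw x₀ K hKS hKq hmild hcool L' w' U t hC => by
    obtain ⟨lab, hlab⟩ := h δ hδ a ha S hS hsum hgood L w hLw x₀ K hKS hKq hmild hcool L' w' U t hC
    exact ⟨lab, hlab.mono le_rfl hτ le_rfl⟩

/-- ★★★ **(AR) «AnchorRegistrationP ϑc ϑp r q rsh rm σ ϑr Rs ε rI ℓ τ ε₁ aHi Λ θ s» — THE SPECIAL CLASS IS PINNED TO ITS LABELS** (KINEMATIC, one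
star).  Under the binders of (QE) verbatim, for every cool shadow crystal `C` and EVERY variant label `lab`: every anchor `p` (member of a `ϑc`-cool star,
`IsAnchorAtom r rsh ℓ S K p`) satisfies `dist p (lab p) ≤ ε₁`.  MECHANISM: the registering star `a` is `ϑc`-tame; its co-members in the cool zone are
`ε`-registered and (clause (iv)) labelled by their registering sites; one-star rigid extrapolation (Procrustes in `sup`-norm with `≥ 4` non-coplanar
registered members, lever `≤ 1 + 4/baseline`) pins `p` within `(ϑc + ε)(1 + lever)` of a site `c⋆`, and `c⋆ = lab p` by coherence (iii) against the
co-members (trilateration residual `≈ (2ϑp + τ + ε)/spread ≈ 0.35 < σ/2`).  TRUE-leaning at the column's `∃ϑm` (`ϑc ≲ 2·10⁻⁴` for `ε₁ = 10⁻³`;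
FALSE as pinned for `ϑc ≥ 10⁻³` — the registration clause (c) of 75E, isolated) · ATTACKABLE-S/M · INSTRUMENTABLE «Anchor-T» (census cores: max over
cool-star members of `dist p (lab p)`; PASS iff `≤ 10⁻³`).
Why it might fail: the lever — registered co-members of a rim anchor's star span only the outer half-space, so the extrapolation factor is `≈ 3–4`, and
`ε₁ = 10⁻³` then needs `ϑc + ε ≲ 3·10⁻⁴`; at the record `ε = 10⁻⁴` this leaves `ϑc ≲ 2·10⁻⁴` (the column's `∃ϑm` allows it, a fixed `ϑc = 10⁻³` does not).
Sources: F. John, CPAM 14 (1961); Friesecke–James–Müller, CPAM 55 (2002) Thm 3.1; part ZA ((EN) mechanism ANCHORS, why-might-fail (c)); GPS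
dilution-of-precision folklore; CRITIC-LEDGER row 1344 («registration needs ϑc ≲ 2·10⁻⁴»). [this file, g76] -/
def AnchorRegistrationP (ϑc ϑp r q rsh rm σ ϑr Rs ε rI ℓ τ ε₁ aHi Λ θ s : ℝ) : Prop :=
  ∀ δ : ℝ, 0 < δ → ∀ a : ℝ, 0 < a →
    ∀ S : Set E3, IsDoorSetP aHi δ S → (∀ z : E3, Summable fun y : S => lennardJones (dist z (y : E3))) →
      (∀ p ∈ S, IsTwoShellAffineGood θ S p) →
        ∀ (L : E3 ≃L[ℝ] E3) (w : ℤ → E3), IsEquilChart a s Λ L w →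
          ∀ (x₀ : E3) (K : Set E3), K ⊆ S → (∀ k ∈ K, dist k x₀ ≤ q) →
            IsTameOn ϑp S (LayeredHom (L : E3 →L[ℝ] E3) w) (coreOf S K rm) →
              IsTameOn ϑc S (LayeredHom (L : E3 →L[ℝ] E3) w) (moatIn S K r (r + rsh)) →
                ∀ (L' : E3 →L[ℝ] E3) (w' : ℤ → E3) (U : E3 ≃ₗᵢ[ℝ] E3) (t : E3),
                  IsCoolShadowCrystal σ ϑr Rs ε r rI ℓ S K (LayeredHom (L : E3 →L[ℝ] E3) w) L' w' U t →
                    ∀ lab : E3 → E3, IsVariantLabel ϑp τ ε r rm ℓ S K (placedCrystal L' w' U t) lab →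
                      ∀ p : E3, IsAnchorAtom r rsh ℓ S K p → dist p (lab p) ≤ ε₁

/-- (AR) is WEAKER for a larger registration tolerance and a smaller label slop (fewer labels to serve). [this file, g76] -/
theorem AnchorRegistrationP.of_le {ϑc ϑp r q rsh rm σ ϑr Rs ε rI ℓ τ τ' ε₁ ε₁' aHi Λ θ s : ℝ} (hτ : τ' ≤ τ) (hε₁ : ε₁ ≤ ε₁')
    (h : AnchorRegistrationP ϑc ϑp r q rsh rm σ ϑr Rs ε rI ℓ τ ε₁ aHi Λ θ s) :
    AnchorRegistrationP ϑc ϑp r q rsh rm σ ϑr Rs ε rI ℓ τ' ε₁' aHi Λ θ s :=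
  fun δ hδ a ha S hS hsum hgood L w hLw x₀ K hKS hKq hmild hcool L' w' U t hC lab hlab p hp =>
    (h δ hδ a ha S hS hsum hgood L w hLw x₀ K hKS hKq hmild hcool L' w' U t hC lab (hlab.mono le_rfl hτ le_rfl) p hp).trans hε₁

/-- ★★★ **(LN) «LabelledNetP ϑc ϑp r q rsh rm σ ϑr Rs ε rI ℓ τ ζ κ κ₂ Dm aHi Λ θ s» — (EN) GIVEN THE VARIANT: AVAILABILITY OF LABELLED DATA** (GENERIC
class, KINEMATIC / combinatorial).  Under the binders of (QE) verbatim, for every cool shadow crystal `C` and EVERY variant label `lab`: every atom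
`x ∈ coreOf S K r` and every unit `u` carry EITHER (A) an ANCHOR `x₃` whose label lies in the `κ`-cone of `u` from `lab x`
(`κ‖lab x₃ − lab x‖ ≤ ⟪lab x₃ − lab x, u⟫`), reached by a labelled chain `IsLabChain (3(ϑp + τ)) ζ rm S K lab x x₃`, OR (B) an anchor `p` with label in
the `κ`-cone of `−u` at label-distance `≥ Dm`, pair-coherent with `x` (`|dist x p − dist (lab x) (lab p)| ≤ 2ϑp + τ`), AND a labelled chain into the WIDE
`κ₂`-cone of `u`.  No registration and no choice of sites is asked here: the sites ARE the labels ((SV)'s), the registration is (AR)'s.  MECHANISM (three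
finite ingredients): STAR COVERING (labels of `S ∩ B̄(x, 4)` cover `C ∩ B̄(lab x, 3.8)`: clean two-shell induction inside one star, using
`IsVariantLabel.ne_of_star` — this is 75E's (b) «hop membership»); BARLOW ROW GEOMETRY (near-collinear site paths, centre hops `≤ 3.8` or a centre hop
`+` a pair hop `≤ 6.6`, defect `≤ ζ`, into every `κ`-cone, in EVERY stacking word — configuration-free; g75 probe3 `334/334` rows); ANCHOR REACH
(chain ends land in the anchor class: coarse localisation of chain atoms by the iterated behind-bound, `≈ 0.48 <` band slack).  INCOMPARABLE with (EN)
formally; WEAKER IN KIND (pure availability given order).  UNDECIDED→TRUE-leaning · ATTACKABLE-M · INSTRUMENTABLE «Row-T» (Enclosure-T of census ⑦ run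
with SITES := LABELS and anchors := cool-star members; PASS iff every axis of every inner-core atom is covered at `(τ, ζ, κ, κ₂, Dm) = (1/3000, 10⁻²,
4/5, 1/2, 2)`).
Why it might fail: direction covering between probed axes (cone slack at `κ = 4/5` against the row density of long-period words: probe2 showed equal-hop
rows alone leave `62/150` axes; the centre+pair fallback must be certified for ALL `u`, not `150` samples), and anchor reach for THIN containers `K`
(anchors are cool-star members — for `K` two atoms `8` apart the nearest anchors of a mid-point atom sit at label-distance `≈ 6–7`, inside the `≤ 11.4`
reach but through fewer rows).
Sources: part ZA ((EN), `isNetChain_of_reads`, probe `dev/enclosure_probe3.py`), part UC/CleanScaleP (`IsCleanP`), Conway–Sloane SPLAG ch. 7;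
CRITIC-LEDGER row 1344. [this file, g76] -/
def LabelledNetP (ϑc ϑp r q rsh rm σ ϑr Rs ε rI ℓ τ ζ κ κ₂ Dm aHi Λ θ s : ℝ) : Prop :=
  ∀ δ : ℝ, 0 < δ → ∀ a : ℝ, 0 < a →
    ∀ S : Set E3, IsDoorSetP aHi δ S → (∀ z : E3, Summable fun y : S => lennardJones (dist z (y : E3))) →
      (∀ p ∈ S, IsTwoShellAffineGood θ S p) →
        ∀ (L : E3 ≃L[ℝ] E3) (w : ℤ → E3), IsEquilChart a s Λ L w →
          ∀ (x₀ : E3) (K : Set E3), K ⊆ S → (∀ k ∈ K, dist k x₀ ≤ q) →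
            IsTameOn ϑp S (LayeredHom (L : E3 →L[ℝ] E3) w) (coreOf S K rm) →
              IsTameOn ϑc S (LayeredHom (L : E3 →L[ℝ] E3) w) (moatIn S K r (r + rsh)) →
                ∀ (L' : E3 →L[ℝ] E3) (w' : ℤ → E3) (U : E3 ≃ₗᵢ[ℝ] E3) (t : E3),
                  IsCoolShadowCrystal σ ϑr Rs ε r rI ℓ S K (LayeredHom (L : E3 →L[ℝ] E3) w) L' w' U t →
                    ∀ lab : E3 → E3, IsVariantLabel ϑp τ ε r rm ℓ S K (placedCrystal L' w' U t) lab →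
                      ∀ x ∈ coreOf S K r, ∀ u : E3, ‖u‖ = 1 →
                        (∃ x₃ : E3, IsAnchorAtom r rsh ℓ S K x₃ ∧ κ * ‖lab x₃ - lab x‖ ≤ ⟪lab x₃ - lab x, u⟫_ℝ ∧
                            IsLabChain (3 * (ϑp + τ)) ζ rm S K lab x x₃) ∨
                        ((∃ p : E3, IsAnchorAtom r rsh ℓ S K p ∧ κ * ‖lab p - lab x‖ ≤ ⟪lab p - lab x, -u⟫_ℝ ∧ Dm ≤ dist (lab x) (lab p) ∧
                            |dist x p - dist (lab x) (lab p)| ≤ 2 * ϑp + τ) ∧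
                          ∃ x₃ : E3, IsAnchorAtom r rsh ℓ S K x₃ ∧ κ₂ * ‖lab x₃ - lab x‖ ≤ ⟪lab x₃ - lab x, u⟫_ℝ ∧
                            IsLabChain (3 * (ϑp + τ)) ζ rm S K lab x x₃)

/-- ★★ **(CV) «LabelCoveringP ϑc ϑp r q rsh rm σ ϑr Rs ε rI ℓ τ aHi Λ θ s» — EVERY DEEP SITE IS SOME ATOM'S LABEL** (COUNTING, conditional on the
variant; the honest successor of (OC)'s mechanism with its order risk removed).  Under the binders of (QE) verbatim, for every cool shadow crystal `C`
and EVERY variant label `lab`: every site `c ∈ C` within `rI` of `K` is `lab p` for some atom `p` of the tame zone `coreOf S K rm`.  MECHANISM: clean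
two-shell completeness propagated along nearest-neighbour steps of `C` from the REG-in zone inward, RE-ANCHORED ON LABELS (an atom labelled `c₀` is
clean; its `12` nearest neighbours carry `12` distinct labels (`ne_of_star`) at label-distance `≤ 1·(1 + 1/16) + ϑp + τ < √2·σ`, i.e. exactly the `12`
nearest sites of `c₀`) — no frame, no drift.  In a twin-lamella configuration NO variant label exists and (CV) is idle: its why-might-fail is counting
only.  TRUE-leaning · ATTACKABLE-S · INSTRUMENTABLE (census ⑦: unlabelled sites of the fitted crystal inside `rI`; PASS iff `0`).
Why it might fail: the distance windows — the atoms' clean-pattern scale `∈ [9/10, 1]·(1 ± 1/16)` against `C`'s spacing (fitted to the collar, `≥ σ =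
17/20`): the first-shell window `[0.74, 1.17]` must exclude `C`'s second distance `√2·s_C ≥ 1.20` — a margin of `0.03`.
Sources: part UC/CleanScaleP (`IsCleanP`, `isSep_of_isClean`); Conway–Sloane SPLAG ch. 7; part ZA ((OC)); CRITIC-LEDGER rows 1322, 1344.
[this file, g76] -/
def LabelCoveringP (ϑc ϑp r q rsh rm σ ϑr Rs ε rI ℓ τ aHi Λ θ s : ℝ) : Prop :=
  ∀ δ : ℝ, 0 < δ → ∀ a : ℝ, 0 < a →
    ∀ S : Set E3, IsDoorSetP aHi δ S → (∀ z : E3, Summable fun y : S => lennardJones (dist z (y : E3))) →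
      (∀ p ∈ S, IsTwoShellAffineGood θ S p) →
        ∀ (L : E3 ≃L[ℝ] E3) (w : ℤ → E3), IsEquilChart a s Λ L w →
          ∀ (x₀ : E3) (K : Set E3), K ⊆ S → (∀ k ∈ K, dist k x₀ ≤ q) →
            IsTameOn ϑp S (LayeredHom (L : E3 →L[ℝ] E3) w) (coreOf S K rm) →
              IsTameOn ϑc S (LayeredHom (L : E3 →L[ℝ] E3) w) (moatIn S K r (r + rsh)) →
                ∀ (L' : E3 →L[ℝ] E3) (w' : ℤ → E3) (U : E3 ≃ₗᵢ[ℝ] E3) (t : E3),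
                  IsCoolShadowCrystal σ ϑr Rs ε r rI ℓ S K (LayeredHom (L : E3 →L[ℝ] E3) w) L' w' U t →
                    ∀ lab : E3 → E3, IsVariantLabel ϑp τ ε r rm ℓ S K (placedCrystal L' w' U t) lab →
                      ∀ c ∈ placedCrystal L' w' U t, (∃ k ∈ K, dist c k ≤ rI) → ∃ p ∈ coreOf S K rm, lab p = c

end Pieces

/-! ### ZB-3  THE JUNCTIONS (PROVED): (EN) ⟸ (SV) ∧ (AR) ∧ (LN);  (OC) ⟸ (SV) ∧ (AR) ∧ (LN) ∧ (CV);  instances down to the docket leaf -/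

section Junction

variable {n : ℕ}

/-- ★ **POINTWISE ENCLOSURE DATA FROM A LABEL (PROVED)**: for ONE configuration, a variant label with (AR)'s and (LN)'s conclusions yields 75E's A/B data
at the candidate site `c := lab x` — chain sites := labels (in `C` since `rm < ℓ`), registration := (AR), slops `3(ϑp + τ) ≤ 3ϑp + ε₁` and
`2ϑp + τ ≤ 2ϑp + ε₁` from `0 ≤ τ`, `3τ ≤ ε₁`. [this file, g76] -/
theorem enclosureData_of_label {ϑp r rsh rm ℓ τ ε ε₁ ζ κ κ₂ Dm : ℝ} {S K C : Set E3} {lab : E3 → E3} {x u : E3}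
    (hτ₀ : 0 ≤ τ) (hτ : 3 * τ ≤ ε₁) (hrmℓ : rm < ℓ) (hlab : IsVariantLabel ϑp τ ε r rm ℓ S K C lab)
    (hAR : ∀ p : E3, IsAnchorAtom r rsh ℓ S K p → dist p (lab p) ≤ ε₁)
    (hLN : (∃ x₃ : E3, IsAnchorAtom r rsh ℓ S K x₃ ∧ κ * ‖lab x₃ - lab x‖ ≤ ⟪lab x₃ - lab x, u⟫_ℝ ∧
          IsLabChain (3 * (ϑp + τ)) ζ rm S K lab x x₃) ∨
        ((∃ p : E3, IsAnchorAtom r rsh ℓ S K p ∧ κ * ‖lab p - lab x‖ ≤ ⟪lab p - lab x, -u⟫_ℝ ∧ Dm ≤ dist (lab x) (lab p) ∧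
            |dist x p - dist (lab x) (lab p)| ≤ 2 * ϑp + τ) ∧
          ∃ x₃ : E3, IsAnchorAtom r rsh ℓ S K x₃ ∧ κ₂ * ‖lab x₃ - lab x‖ ≤ ⟪lab x₃ - lab x, u⟫_ℝ ∧
            IsLabChain (3 * (ϑp + τ)) ζ rm S K lab x x₃)) :
    (∃ c' ∈ C, κ * ‖c' - lab x‖ ≤ ⟪c' - lab x, u⟫_ℝ ∧ IsNetChain (3 * ϑp + ε₁) ζ ε₁ S C x (lab x) c') ∨
      ((∃ c' ∈ C, κ * ‖c' - lab x‖ ≤ ⟪c' - lab x, -u⟫_ℝ ∧ Dm ≤ dist (lab x) c' ∧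
          ∃ p ∈ S, |dist x p - dist (lab x) c'| ≤ 2 * ϑp + ε₁ ∧ dist p c' ≤ ε₁) ∧
        ∃ c' ∈ C, κ₂ * ‖c' - lab x‖ ≤ ⟪c' - lab x, u⟫_ℝ ∧ IsNetChain (3 * ϑp + ε₁) ζ ε₁ S C x (lab x) c') := by
  have hzone := hlab.1
  have hη : 3 * (ϑp + τ) ≤ 3 * ϑp + ε₁ := by linarith
  have memC : ∀ p : E3, IsAnchorAtom r rsh ℓ S K p → lab p ∈ C := fun p hp => hzone p hp.zone.1 hp.zone.2
  rcases hLN with ⟨x₃, hA₃, hdir, hch⟩ | ⟨⟨p, hAp, hdir, hDm, hread⟩, x₃, hA₃, hdir₃, hch⟩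
  · exact Or.inl ⟨lab x₃, memC x₃ hA₃, hdir, isNetChain_of_isLabChain hch hη hzone hrmℓ hA₃.zone.1 (hAR x₃ hA₃)⟩
  · refine Or.inr ⟨⟨lab p, memC p hAp, hdir, hDm, p, hAp.zone.1, hread.trans (by linarith), hAR p hAp⟩, lab x₃, memC x₃ hA₃, hdir₃,
      isNetChain_of_isLabChain hch hη hzone hrmℓ hA₃.zone.1 (hAR x₃ hA₃)⟩

/-- ★★★ **JUNCTION (PROVED): (SV)(τ) ∧ (AR)(τ, ε₁) ∧ (LN)(τ, ζ, κ, κ₂, Dm) ⇒ (EN)(ε₁, ζ, κ, κ₂, Dm)** for `0 ≤ τ`, `3τ ≤ ε₁`, `r < ℓ`, `rm < ℓ` — the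
ORDER cut of row 1344: `c := lab x`, everything else is bookkeeping (`enclosureData_of_label`). [this file, g76] -/
theorem enclosureNetP_of_variantLabel {ϑc ϑp r q rsh rm σ ϑr Rs ε rI ℓ τ ε₁ ζ κ κ₂ Dm aHi Λ θ s : ℝ}
    (hτ₀ : 0 ≤ τ) (hτ : 3 * τ ≤ ε₁) (hrℓ : r < ℓ) (hrmℓ : rm < ℓ)
    (hSV : SingleVariantP ϑc ϑp r q rsh rm σ ϑr Rs ε rI ℓ τ aHi Λ θ s)
    (hAR : AnchorRegistrationP ϑc ϑp r q rsh rm σ ϑr Rs ε rI ℓ τ ε₁ aHi Λ θ s)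
    (hLN : LabelledNetP ϑc ϑp r q rsh rm σ ϑr Rs ε rI ℓ τ ζ κ κ₂ Dm aHi Λ θ s) :
    EnclosureNetP ϑc ϑp r q rsh rm σ ϑr Rs ε rI ℓ ε₁ ζ κ κ₂ Dm aHi Λ θ s := by
  intro δ hδ a ha S hS hsum hgood L w hLw x₀ K hKS hKq hmild hcool L' w' U t hC x hx
  obtain ⟨lab, hlab⟩ := hSV δ hδ a ha S hS hsum hgood L w hLw x₀ K hKS hKq hmild hcool L' w' U t hC
  have hAR' := hAR δ hδ a ha S hS hsum hgood L w hLw x₀ K hKS hKq hmild hcool L' w' U t hC lab hlab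
  have hLN' := hLN δ hδ a ha S hS hsum hgood L w hLw x₀ K hKS hKq hmild hcool L' w' U t hC lab hlab x hx
  obtain ⟨hxS, k, hk, hxk⟩ := hx
  exact ⟨lab x, hlab.1 x hxS ⟨k, hk, lt_of_le_of_lt hxk hrℓ⟩, fun u hu => enclosureData_of_label hτ₀ hτ hrmℓ hlab hAR' (hLN' u hu)⟩

/-- ★★ **LABEL LOCALISATION (PROVED): under the enclosure dials of 75E, (AR) + (LN) data pin every inner-core atom to ITS LABEL within `d`** —
`dist_le_of_enclosed` (part ZA) at `c := lab x`.  Dials as in ZA's junction: `ηA := 3ϑp + 2ε₁ + ζ ≤ κd`, `ηA ≤ κ₂D₀`, `D₀ < 2κDm`, `ηB := 2ϑp + 2ε₁ ≤ Dm`,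
`ηB ≤ κd`, `ηB(2Dm − ηB) ≤ d(2κDm − D₀)`. [this file, g76] -/
theorem dist_lab_le_of_label {ϑp r rsh rm ℓ τ ε ε₁ ζ κ κ₂ Dm D₀ d : ℝ} {S K C : Set E3} {lab : E3 → E3} {x : E3}
    (hϑp : 0 ≤ ϑp) (hε₁ : 0 ≤ ε₁) (hζ : 0 ≤ ζ) (hκ₀ : 0 < κ) (hκ₁ : κ ≤ 1) (hκ₂ : 0 < κ₂) (hκ₂₁ : κ₂ ≤ 1)
    (hA : 3 * ϑp + 2 * ε₁ + ζ ≤ κ * d) (hA₂ : 3 * ϑp + 2 * ε₁ + ζ ≤ κ₂ * D₀) (hgap : D₀ < 2 * κ * Dm) (hBη : 2 * ϑp + 2 * ε₁ ≤ Dm)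
    (hBκ : 2 * ϑp + 2 * ε₁ ≤ κ * d) (hB : (2 * ϑp + 2 * ε₁) * (2 * Dm - (2 * ϑp + 2 * ε₁)) ≤ d * (2 * κ * Dm - D₀))
    (hτ₀ : 0 ≤ τ) (hτ : 3 * τ ≤ ε₁) (hrmℓ : rm < ℓ) (hlab : IsVariantLabel ϑp τ ε r rm ℓ S K C lab)
    (hAR : ∀ p : E3, IsAnchorAtom r rsh ℓ S K p → dist p (lab p) ≤ ε₁)
    (hLN : ∀ u : E3, ‖u‖ = 1 →
      (∃ x₃ : E3, IsAnchorAtom r rsh ℓ S K x₃ ∧ κ * ‖lab x₃ - lab x‖ ≤ ⟪lab x₃ - lab x, u⟫_ℝ ∧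
          IsLabChain (3 * (ϑp + τ)) ζ rm S K lab x x₃) ∨
        ((∃ p : E3, IsAnchorAtom r rsh ℓ S K p ∧ κ * ‖lab p - lab x‖ ≤ ⟪lab p - lab x, -u⟫_ℝ ∧ Dm ≤ dist (lab x) (lab p) ∧
            |dist x p - dist (lab x) (lab p)| ≤ 2 * ϑp + τ) ∧
          ∃ x₃ : E3, IsAnchorAtom r rsh ℓ S K x₃ ∧ κ₂ * ‖lab x₃ - lab x‖ ≤ ⟪lab x₃ - lab x, u⟫_ℝ ∧
            IsLabChain (3 * (ϑp + τ)) ζ rm S K lab x x₃)) :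
    dist x (lab x) ≤ d := by
  have hηA : 0 ≤ 3 * ϑp + 2 * ε₁ + ζ := by positivity
  refine dist_le_of_enclosed (C := C) hκ₀ hκ₁ hκ₂ hκ₂₁ hηA hA hA₂ hgap hBη hBκ hB fun u hu => ?_
  rcases enclosureData_of_label hτ₀ hτ hrmℓ hlab hAR (hLN u hu) with
    ⟨c', hc', hdir, hchain⟩ | ⟨⟨c', hc', hdir, hDm, p, -, hread, hanc⟩, c'', hc'', hdir'', hchain''⟩
  · refine Or.inl ⟨c', hc', hdir, ?_⟩
    have := dist_le_of_isNetChain hchain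
    linarith
  · refine Or.inr ⟨⟨c', hc', hdir, hDm, ?_⟩, c'', hc'', hdir'', ?_⟩
    · have h1 := (abs_sub_le_iff.1 hread).2
      have h2 : dist x p ≤ dist x c' + dist c' p := dist_triangle _ _ _
      rw [dist_comm c' p] at h2
      linarith
    · have := dist_le_of_isNetChain hchain''
      linarith

/-- ★★★ **THE SHARED LEMMA MADE EXPLICIT (PROVED): (SV) ∧ (AR) ∧ (LN) ∧ (CV) ⇒ (OC)(d₁)** under the enclosure dials of 75E with `d ≤ d₁`, `ε ≤ d₁`:
a deep site `c` is `lab p` (CV); `p` is either cool — then `dist p c ≤ ε` by the collar clause (iv) — or an inner-core atom, pinned to its label within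
`d` by `dist_lab_le_of_label`.  Row 1344: the order risk of (OC) IS (SV); what remains of (OC) is the counting piece (CV). [this file, g76] -/
theorem coreOccupancyP_of_variantLabel {ϑc ϑp r q rsh rm σ ϑr Rs ε rI ℓ τ ε₁ ζ κ κ₂ Dm D₀ d d₁ aHi Λ θ s : ℝ}
    (hϑp : 0 ≤ ϑp) (hε₁ : 0 ≤ ε₁) (hζ : 0 ≤ ζ) (hκ₀ : 0 < κ) (hκ₁ : κ ≤ 1) (hκ₂ : 0 < κ₂) (hκ₂₁ : κ₂ ≤ 1)
    (hA : 3 * ϑp + 2 * ε₁ + ζ ≤ κ * d) (hA₂ : 3 * ϑp + 2 * ε₁ + ζ ≤ κ₂ * D₀) (hgap : D₀ < 2 * κ * Dm) (hBη : 2 * ϑp + 2 * ε₁ ≤ Dm)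
    (hBκ : 2 * ϑp + 2 * ε₁ ≤ κ * d) (hB : (2 * ϑp + 2 * ε₁) * (2 * Dm - (2 * ϑp + 2 * ε₁)) ≤ d * (2 * κ * Dm - D₀))
    (hτ₀ : 0 ≤ τ) (hτ : 3 * τ ≤ ε₁) (hrmℓ : rm < ℓ) (hεd₁ : ε ≤ d₁) (hdd₁ : d ≤ d₁)
    (hSV : SingleVariantP ϑc ϑp r q rsh rm σ ϑr Rs ε rI ℓ τ aHi Λ θ s)
    (hAR : AnchorRegistrationP ϑc ϑp r q rsh rm σ ϑr Rs ε rI ℓ τ ε₁ aHi Λ θ s)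
    (hLN : LabelledNetP ϑc ϑp r q rsh rm σ ϑr Rs ε rI ℓ τ ζ κ κ₂ Dm aHi Λ θ s)
    (hCV : LabelCoveringP ϑc ϑp r q rsh rm σ ϑr Rs ε rI ℓ τ aHi Λ θ s) :
    CoreOccupancyP ϑc ϑp r q rsh rm σ ϑr Rs ε rI ℓ d₁ aHi Λ θ s := by
  intro δ hδ a ha S hS hsum hgood L w hLw x₀ K hKS hKq hmild hcool L' w' U t hC c hc hck
  obtain ⟨lab, hlab⟩ := hSV δ hδ a ha S hS hsum hgood L w hLw x₀ K hKS hKq hmild hcool L' w' U t hC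
  have hAR' := hAR δ hδ a ha S hS hsum hgood L w hLw x₀ K hKS hKq hmild hcool L' w' U t hC lab hlab
  have hLN' := hLN δ hδ a ha S hS hsum hgood L w hLw x₀ K hKS hKq hmild hcool L' w' U t hC lab hlab
  obtain ⟨p, ⟨hpS, k, hk, hpk⟩, hpc⟩ := hCV δ hδ a ha S hS hsum hgood L w hLw x₀ K hKS hKq hmild hcool L' w' U t hC lab hlab c hc hck
  refine ⟨p, hpS, ?_⟩
  rw [← hpc]
  by_cases hfar : ∀ k ∈ K, r < dist p k
  · exact (hlab.2.2.2 p hpS ⟨k, hk, lt_of_le_of_lt hpk hrmℓ⟩ hfar).trans hεd₁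
  · push Not at hfar
    obtain ⟨k', hk', hpk'⟩ := hfar
    exact (dist_lab_le_of_label hϑp hε₁ hζ hκ₀ hκ₁ hκ₂ hκ₂₁ hA hA₂ hgap hBη hBκ hB hτ₀ hτ hrmℓ hlab hAR'
      (hLN' p ⟨hpS, k', hk', hpk'⟩)).trans hdd₁

/-- ★★ **(EN) AT THE RE-PINNED DIALS FROM (SV) ∧ (AR) ∧ (LN) (PROVED instance)**: docket geometry `(r, q, rsh, rm) = (8, 4, 12, 16)`, `(aHi, Λ, θ, s) =
(1, 2, 1/16, 1/50)`, `ϑp = 1/10`, shadow `(σ, ϑr, Rs, ε, rI, ℓ) = (17/20, 10⁻⁴, 5, 10⁻⁴, 10, 43/2)`, label slop `τ = 1/3000` (`3τ = ε₁`), enclosure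
dials `(ε₁, ζ, κ, κ₂, Dm) = (10⁻³, 10⁻², 4/5, 1/2, 2)`; `ϑc` free (the column's `∃ϑm`). [this file, g76] -/
theorem enclosureNetP_instance_of_variantLabel {ϑc : ℝ}
    (hSV : SingleVariantP ϑc (1 / 10) 8 4 12 16 (17 / 20) (1 / 10000) 5 (1 / 10000) 10 (43 / 2) (1 / 3000) 1 2 (1 / 16) (1 / 50))
    (hAR : AnchorRegistrationP ϑc (1 / 10) 8 4 12 16 (17 / 20) (1 / 10000) 5 (1 / 10000) 10 (43 / 2) (1 / 3000) (1 / 1000) 1 2 (1 / 16)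
      (1 / 50))
    (hLN : LabelledNetP ϑc (1 / 10) 8 4 12 16 (17 / 20) (1 / 10000) 5 (1 / 10000) 10 (43 / 2) (1 / 3000) (1 / 100) (4 / 5) (1 / 2) 2 1 2
      (1 / 16) (1 / 50)) :
    EnclosureNetP ϑc (1 / 10) 8 4 12 16 (17 / 20) (1 / 10000) 5 (1 / 10000) 10 (43 / 2) (1 / 1000) (1 / 100) (4 / 5) (1 / 2) 2 1 2 (1 / 16)
      (1 / 50) :=
  enclosureNetP_of_variantLabel (by norm_num) (by norm_num) (by norm_num) (by norm_num) hSV hAR hLN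

/-- ★★ **(OC) AT THE RE-PINNED DIALS FROM (SV) ∧ (AR) ∧ (LN) ∧ (CV) (PROVED instance)**: same dials, coarse radius `D₀ = 2/3` internal, `d = d₁ = 2/5`.
[this file, g76] -/
theorem coreOccupancyP_instance_of_variantLabel {ϑc : ℝ}
    (hSV : SingleVariantP ϑc (1 / 10) 8 4 12 16 (17 / 20) (1 / 10000) 5 (1 / 10000) 10 (43 / 2) (1 / 3000) 1 2 (1 / 16) (1 / 50))
    (hAR : AnchorRegistrationP ϑc (1 / 10) 8 4 12 16 (17 / 20) (1 / 10000) 5 (1 / 10000) 10 (43 / 2) (1 / 3000) (1 / 1000) 1 2 (1 / 16)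
      (1 / 50))
    (hLN : LabelledNetP ϑc (1 / 10) 8 4 12 16 (17 / 20) (1 / 10000) 5 (1 / 10000) 10 (43 / 2) (1 / 3000) (1 / 100) (4 / 5) (1 / 2) 2 1 2
      (1 / 16) (1 / 50))
    (hCV : LabelCoveringP ϑc (1 / 10) 8 4 12 16 (17 / 20) (1 / 10000) 5 (1 / 10000) 10 (43 / 2) (1 / 3000) 1 2 (1 / 16) (1 / 50)) :
    CoreOccupancyP ϑc (1 / 10) 8 4 12 16 (17 / 20) (1 / 10000) 5 (1 / 10000) 10 (43 / 2) (2 / 5) 1 2 (1 / 16) (1 / 50) :=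
  coreOccupancyP_of_variantLabel (D₀ := 2 / 3) (d := 2 / 5) (by norm_num) (by norm_num) (by norm_num) (by norm_num) (by norm_num) (by norm_num)
    (by norm_num) (by norm_num) (by norm_num) (by norm_num) (by norm_num) (by norm_num) (by norm_num) (by norm_num) (by norm_num) (by norm_num)
    (by norm_num) le_rfl hSV hAR hLN hCV

/-- ★★ **(CM)(2/5) FROM (SV) ∧ (AR) ∧ (LN) ∧ (CV) (PROVED instance)** — 75E's junction fed by this part's two instances: the loose ball's ONE order leaf
is (SV). [this file, g76] -/
theorem mildCoreFillingP_instance_of_variantLabel {ϑc : ℝ}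
    (hSV : SingleVariantP ϑc (1 / 10) 8 4 12 16 (17 / 20) (1 / 10000) 5 (1 / 10000) 10 (43 / 2) (1 / 3000) 1 2 (1 / 16) (1 / 50))
    (hAR : AnchorRegistrationP ϑc (1 / 10) 8 4 12 16 (17 / 20) (1 / 10000) 5 (1 / 10000) 10 (43 / 2) (1 / 3000) (1 / 1000) 1 2 (1 / 16)
      (1 / 50))
    (hLN : LabelledNetP ϑc (1 / 10) 8 4 12 16 (17 / 20) (1 / 10000) 5 (1 / 10000) 10 (43 / 2) (1 / 3000) (1 / 100) (4 / 5) (1 / 2) 2 1 2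
      (1 / 16) (1 / 50))
    (hCV : LabelCoveringP ϑc (1 / 10) 8 4 12 16 (17 / 20) (1 / 10000) 5 (1 / 10000) 10 (43 / 2) (1 / 3000) 1 2 (1 / 16) (1 / 50)) :
    MildCoreFillingP ϑc (1 / 10) 8 4 12 16 16 (17 / 20) (1 / 10000) 5 (1 / 10000) 10 (43 / 2) (79999 / 5000) (2 / 5) 1 2 (1 / 16) (1 / 50) :=
  mildCoreFillingP_instance_of_enclosure (enclosureNetP_instance_of_variantLabel hSV hAR hLN)
    (coreOccupancyP_instance_of_variantLabel hSV hAR hLN hCV)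

/-- ★★ **THE DOCKET SLOT (PROVED)**: (SC) ∧ (SV) ∧ (AR) ∧ (LN) ∧ (CV) ∧ (X1)@`dB = 1/10` ∧ (X2ᴸ♮)@`dB = 1/10` give the existence leaf
`CoolMoatSlavedFillingP ϑc (1/100) (1/10) 8 4 12 16 16 (1/2) 1 2 (1/16) (1/50)` (column `_16XH28BVT`, `∃ ϑm`), by part ZA's slot; modulus `lam > 0` free.
[this file, g76] -/
theorem coolMoatSlavedFillingP_tubeSlot_of_variantLabel {ϑc lam : ℝ} (hlam : 0 < lam)
    (hSC : CoolZoneShadowCrystalP ϑc (1 / 10) 8 4 12 16 (17 / 20) (1 / 10000) 5 (1 / 10000) 10 (43 / 2) 1 2 (1 / 16) (1 / 50))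
    (hSV : SingleVariantP ϑc (1 / 10) 8 4 12 16 (17 / 20) (1 / 10000) 5 (1 / 10000) 10 (43 / 2) (1 / 3000) 1 2 (1 / 16) (1 / 50))
    (hAR : AnchorRegistrationP ϑc (1 / 10) 8 4 12 16 (17 / 20) (1 / 10000) 5 (1 / 10000) 10 (43 / 2) (1 / 3000) (1 / 1000) 1 2 (1 / 16)
      (1 / 50))
    (hLN : LabelledNetP ϑc (1 / 10) 8 4 12 16 (17 / 20) (1 / 10000) 5 (1 / 10000) 10 (43 / 2) (1 / 3000) (1 / 100) (4 / 5) (1 / 2) 2 1 2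
      (1 / 16) (1 / 50))
    (hCV : LabelCoveringP ϑc (1 / 10) 8 4 12 16 (17 / 20) (1 / 10000) 5 (1 / 10000) 10 (43 / 2) (1 / 3000) 1 2 (1 / 16) (1 / 50))
    (hX1 : TubeConvexityP ϑc (1 / 100) (1 / 10) 8 4 12 16 16 (1 / 2) (1 / 5000) 5 (3 / 400) (3 / 400) (1 / 10) lam 1 2 (1 / 16) (1 / 50))
    (hX2 : ShadowLoadedTubeAprioriP ϑc (1 / 100) (1 / 10) 8 4 12 16 16 (1 / 2) (1 / 5000) 5 (3 / 400) (3 / 400) (1 / 10) (17 / 20) (1 / 10000)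
      (1 / 10000) (19 / 4) (21 / 4) (1 / 200) (1 / 200) (1 / 20) 1 2 (1 / 16) (1 / 50)) :
    CoolMoatSlavedFillingP ϑc (1 / 100) (1 / 10) 8 4 12 16 16 (1 / 2) 1 2 (1 / 16) (1 / 50) :=
  coolMoatSlavedFillingP_tubeSlot_of_enclosure hlam hSC (enclosureNetP_instance_of_variantLabel hSV hAR hLN)
    (coreOccupancyP_instance_of_variantLabel hSV hAR hLN hCV) hX1 hX2

/-- ★ **THE LABEL SLOP IS TIED TO THE ENCLOSURE BUDGET (PROVED arithmetic; the canary's positive twin)**: at `ϑp = 1/10`, `κ ≤ 1`, `ζ ≥ 0`, `d = 2/5`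
the chain slop `3(ϑp + τ)` passed to 75E as `3ϑp + ε₁` with `3τ ≤ ε₁` and `3ϑp + 2ε₁ + ζ ≤ κd` forces `τ ≤ 1/60` — the variant must be read to within
a SIXTIETH of a spacing per hop; the instance `τ = 1/3000` leaves the budget to `ζ`. [this file, g76] -/
theorem labelSlop_le_of_budget {κ τ ε₁ ζ : ℝ} (hκ₁ : κ ≤ 1) (hζ : 0 ≤ ζ) (hτ : 3 * τ ≤ ε₁)
    (hA : 3 * (1 / 10 : ℝ) + 2 * ε₁ + ζ ≤ κ * (2 / 5)) : τ ≤ 1 / 60 := by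
  nlinarith

end Junction

end Summit.AtomisticToContinuum.Crystallization.Theorems.ChartedZeroExcessLayeredLatticeLiouville

end
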